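import Summits.CriticalPhenomena.PercolationContinuityZ3.Theorems.Transplant.SkelNegBParamsFaceFloorsX2TA
import Summits.CriticalPhenomena.PercolationContinuityZ3.Theorems.Transplant.SkelNegBParamsFaceBandRoomA
import Summits.CriticalPhenomena.PercolationContinuityZ3.Theorems.Transplant.SkelNegBParamsFaceBandA2
import Summits.CriticalPhenomena.PercolationContinuityZ3.Theorems.Transplant.SkelNegBParamsSlotsTA
import Summits.CriticalPhenomena.PercolationContinuityZ3.Theorems.Transplant.SkelNegBParamsResidualsA
import HarnessLib

/-!
# N1 (the `{±1}` node), M3: **THE x-FACE FLOORS AT THE (ζ′) SLOT VALUES WITH THE PARAMETER HYPOTHESES DISCHARGED** — at `mk := 0`,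
# `g := KS.gT 0 (KS.gxA c)`, `f := KS.fT 0 KS.fxA` (any bridge index `c`; slot-ledger v3 instantiates `c := cK κ` POINTWISE in κ, so these per-κ
# theorems serve `gxAK` verbatim), band `E := KS.RlevA 0 + KS.reachA 0`, transverse offset `kE := (prFA …).kFF₂ (fcellsA …) (E − 1) 0`:
# **`KS.floorsX2_hyps_A`** discharges the ten standard hypotheses of `KS.floorsX2_XFs/d/t` (X2SA/X2TA) — `hnA` (`KS.nL_floorsA.1`),
# `hℓA` (`KS.ML_floorsA.1` + `EqNumL.ℓ_le`), `hS` (`KS.ML_floorsA.2.2.2.1`), `hs0` (`KS.cells_geTA'`), `hkF0/hkF1` (`KS.kFA_le`), `hEu/hE2`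
# (`KS.RA'_eq`, `KS.T₀a_lt_RA'`: `E ≤ 2RA′ − 2 ≤ u₀A`), `hkE/hkE2` (`KS.hkE2_RA₂` at `Rl := E − 1 ≤ 2RA′`, `NegB.apronRl_le`) — and
# **`KS.floorsX2_XFs_A / floorsX2_XFd_A / floorsX2_XFt_A`** are the three `Skelφ.FloorsX2` packages with ONLY the genuinely per-point hypotheses
# left: `hN hκ` (from `AtQO`), the cell data `x du (hd : du.1 = 0) j hj z hlev1 hlev2 hz` (the glue's binders, `du.1` rewritten to `0`), per case
# (and **`KS.floorsX_XFs_A / floorsX_XFd_A / floorsX_XFt_A`** = the same in the glue's literal `∀ x du j z, du.1 = 0 → …` binder shape),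
# `hside/htop` and `hℓb : 2·bF + 27 ≤ ℓBF` (the F pair's geometric clause, `KS.ℓBF_ge`), and `r` with `hr : ∀ X, X + 1 ≤ exA → X ≤ r` (the S slot's `Lp`).

builds on p205010 (kernel theorem, internal audit signed; external expert review pending) — nothing in this file uses p205010; NOTHING is claimed about
the open node `SamePDropOfSkeletonNeg₁`: this is the x-face half of the (F) glue's `FloorsS/FloorsD/FloorsT` packages (hp-8 F-GLUE-CONSUMER-SHAPE.md §1).
Lane `prim-bschramm`, seat `prim-bschramm-p3` (gen 12; N1 design owner, M3 integrator); helper file (`--supports stmt-CriticalPhenomena-4575 --as helper`).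
[cite: KozmaNitzan2024, §4 Lemma 11–12 (pp. 21–25), p. 28 ((32))] [cite: MartineauTassion2017, §4.3]
-/

noncomputable section

open scoped Classical

namespace Summit.CriticalPhenomena.PercolationContinuityZ3.Theorems.Transplant

namespace PlanarSkeletonNeg

namespace NegB

open Literature.Probability.Percolation Literature.Probability.LatticeModels SimpleGraph KNCells KNLevels
open Literature.Probability.Percolation.KozmaNitzan.Cells (oth sgOf sgOf_sign stepVec_apply_fst)
open SkelConc (Consts)
open Skelφ (shearUnit shearUnit_pos)
open Skelφ.StepI (DataN)
open ChainPlanar (BridgePrm)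
open TwoAxis.Para (modulus)
open Neg

namespace KS

variable (κ : Consts) {V : Type} [DecidableEq V] [Countable V] {G : SimpleGraph V} [G.LocallyFinite] (Φ : PlanarSkeletonNeg G) (t : V)
  (p : unitInterval) (D : DataN V) (c : ℕ)

/-- **The ten standard hypotheses of the x-face assembly at the (ζ′) slot values** (`mk := 0`, `g := gT 0 (gxA c)`, `f := fT 0 fxA`,
`E := RlevA 0 + reachA 0`, `kE := kFF₂ … (E − 1) 0`). [folklore] -/
theorem floorsX2_hyps_A (hN : EqNumL κ Φ t p D (gT 0 (gxA c) κ Φ t p D) (fT 0 fxA κ Φ t p D)) (hκ : (hL κ Φ t p D (gT 0 (gxA c) κ Φ t p D) (fT 0 fxA κ Φ t p D)).natAbs ≤ 10 * nL κ Φ t p D (gT 0 (gxA c) κ Φ t p D) (fT 0 fxA κ Φ t p D)) :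
    2000 * Neg.Kq κ * (RA' κ Φ t p D 0 + 2) ≤ nL κ Φ t p D (gT 0 (gxA c) κ Φ t p D) (fT 0 fxA κ Φ t p D) ∧
    22000 * Neg.Kq κ * (RA' κ Φ t p D 0 + 2) ≤ ℓL κ Φ t p D (gT 0 (gxA c) κ Φ t p D) (fT 0 fxA κ Φ t p D) ∧
    16 * SF κ Φ t p D c 0 ≤ ML κ Φ t p D (gT 0 (gxA c) κ Φ t p D) ∧
    6 * (RA' κ Φ t p D 0 : ℤ) + 11 ≤ u₀A κ Φ t p D (gT 0 (gxA c) κ Φ t p D) (fT 0 fxA κ Φ t p D) ∧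
    kF₀A κ Φ t p D c 0 (gT 0 (gxA c) κ Φ t p D) (fT 0 fxA κ Φ t p D) ≤ 8 * u₀A κ Φ t p D (gT 0 (gxA c) κ Φ t p D) (fT 0 fxA κ Φ t p D) + 1 ∧
    kF₁A κ Φ t p D c 0 (gT 0 (gxA c) κ Φ t p D) (fT 0 fxA κ Φ t p D) ≤ 8 * u₁A κ Φ t p D (gT 0 (gxA c) κ Φ t p D) (fT 0 fxA κ Φ t p D) + 1 ∧
    (((RlevA κ Φ t p D 0 + reachA t D 0) : ℕ) : ℤ) ≤ u₀A κ Φ t p D (gT 0 (gxA c) κ Φ t p D) (fT 0 fxA κ Φ t p D) ∧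
    (((RlevA κ Φ t p D 0 + reachA t D 0) : ℕ) : ℤ) ≤ 2 * (RA' κ Φ t p D 0 : ℤ) ∧
    ((prFA κ Φ t p D (gT 0 (gxA c) κ Φ t p D) (fT 0 fxA κ Φ t p D)).kFF₂ (fcellsA κ Φ t p D (gT 0 (gxA c) κ Φ t p D) (fT 0 fxA κ Φ t p D)) ((RlevA κ Φ t p D 0 + reachA t D 0) - 1) 0) ≤ 5 * ((fcellsA κ Φ t p D (gT 0 (gxA c) κ Φ t p D) (fT 0 fxA κ Φ t p D)).r 1 : ℤ) ∧
    2 * ((prFA κ Φ t p D (gT 0 (gxA c) κ Φ t p D) (fT 0 fxA κ Φ t p D)).kFF₂ (fcellsA κ Φ t p D (gT 0 (gxA c) κ Φ t p D) (fT 0 fxA κ Φ t p D)) ((RlevA κ Φ t p D 0 + reachA t D 0) - 1) 0) + 8 * u₁A κ Φ t p D (gT 0 (gxA c) κ Φ t p D) (fT 0 fxA κ Φ t p D) + 8 ≤ 5 * ((fcellsA κ Φ t p D (gT 0 (gxA c) κ Φ t p D) (fT 0 fxA κ Φ t p D)).r 1 : ℤ) := by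
  have hML := ML_floorsA κ Φ t p D c
  have hnL := (nL_floorsA κ Φ t p D (gT 0 (gxA c) κ Φ t p D)).1
  have hnA : 2000 * Neg.Kq κ * (RA' κ Φ t p D 0 + 2) ≤ nL κ Φ t p D (gT 0 (gxA c) κ Φ t p D) (fT 0 fxA κ Φ t p D) :=
    le_trans (Nat.mul_le_mul_right _ (Nat.mul_le_mul_right _ (by norm_num))) hnL
  have hℓA : 22000 * Neg.Kq κ * (RA' κ Φ t p D 0 + 2) ≤ ℓL κ Φ t p D (gT 0 (gxA c) κ Φ t p D) (fT 0 fxA κ Φ t p D) := by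
    have h1 := hML.1
    have h2 := hN.ℓ_le
    have h3 : ML κ Φ t p D (gT 0 (gxA c) κ Φ t p D) ≤ ℓL κ Φ t p D (gT 0 (gxA c) κ Φ t p D) (fT 0 fxA κ Φ t p D) := by omega
    exact le_trans (le_trans (Nat.mul_le_mul_right _ (Nat.mul_le_mul_right _ (by norm_num))) h1) h3
  have hS := hML.2.2.2.1
  obtain ⟨hs0, -⟩ := cells_geTA' κ Φ t p D 0 (gxA c) (fT 0 fxA κ Φ t p D) hN hκ
  obtain ⟨hkF0, hkF1⟩ := kFA_le κ Φ t p D c 0 (gxA c) (fT 0 fxA κ Φ t p D) hN hκ hS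
  have hRA := RA'_eq κ Φ t p D 0
  have hre := (T₀a_lt_RA' κ Φ t p D 0).2.2.1
  have hE2n : (RlevA κ Φ t p D 0 + reachA t D 0) + 2 ≤ 2 * RA' κ Φ t p D 0 := by omega
  have hE2 : (((RlevA κ Φ t p D 0 + reachA t D 0) : ℕ) : ℤ) ≤ 2 * (RA' κ Φ t p D 0 : ℤ) := by exact_mod_cast (by omega : (RlevA κ Φ t p D 0 + reachA t D 0) ≤ 2 * RA' κ Φ t p D 0)
  have hR0 : (0 : ℤ) ≤ (RA' κ Φ t p D 0 : ℤ) := by positivity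
  have hEu : (((RlevA κ Φ t p D 0 + reachA t D 0) : ℕ) : ℤ) ≤ u₀A κ Φ t p D (gT 0 (gxA c) κ Φ t p D) (fT 0 fxA κ Φ t p D) := by
    have : 6 * (RA' κ Φ t p D 0 : ℤ) + 11 ≤ u₀A κ Φ t p D (gT 0 (gxA c) κ Φ t p D) (fT 0 fxA κ Φ t p D) := hs0
    linarith
  have hRl := apronRl_le κ Φ t p D 0
  have h2 := hkE2_RA₂ κ Φ t p D (fT 0 fxA κ Φ t p D) 0 (gxA c) hN hκ hRl (0 : Fin 2)
  rw [show oth (0 : Fin 2) = 1 from rfl, if_neg (show ¬((1 : Fin 2) = 0) by decide)] at h2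
  have hu1 : 1 ≤ u₁A κ Φ t p D (gT 0 (gxA c) κ Φ t p D) (fT 0 fxA κ Φ t p D) := (units_eqA κ Φ t p D (gT 0 (gxA c) κ Φ t p D) (fT 0 fxA κ Φ t p D)).2.2.2.2.2.2.2
  have hr1 : (0 : ℤ) ≤ ((fcellsA κ Φ t p D (gT 0 (gxA c) κ Φ t p D) (fT 0 fxA κ Φ t p D)).r 1 : ℤ) := by positivity
  exact ⟨hnA, hℓA, hS, hs0, hkF0, hkF1, hEu, hE2, by linarith, h2⟩

set_option maxHeartbeats 4000000 in
/-- **M3, x-face, bridge case same: `Skelφ.FloorsX2` at the (ζ′) slot values, parameter hypotheses discharged** (`KS.floorsX2_XFs` ∘ `KS.floorsX2_hyps_A`). [cite: KozmaNitzan2024, §4 Lemma 11–12 (pp. 21–25)] -/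
theorem floorsX2_XFs_A (c : ℕ)
    (hN : EqNumL κ Φ t p D (gT 0 (gxA c) κ Φ t p D) (fT 0 fxA κ Φ t p D)) (hκ : (hL κ Φ t p D (gT 0 (gxA c) κ Φ t p D) (fT 0 fxA κ Φ t p D)).natAbs ≤ 10 * nL κ Φ t p D (gT 0 (gxA c) κ Φ t p D) (fT 0 fxA κ Φ t p D))
    (x : Site 2) (du : MDir) (hd : du.1 = 0) (j : ℕ) (hj : j < (fcellsA κ Φ t p D (gT 0 (gxA c) κ Φ t p D) (fT 0 fxA κ Φ t p D)).K) (z : Site 2)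
    (hlev1 : (fcellsA κ Φ t p D (gT 0 (gxA c) κ Φ t p D) (fT 0 fxA κ Φ t p D)).faceL 0 j - (((RlevA κ Φ t p D 0 + reachA t D 0) : ℕ) : ℤ) ≤ (fcellsA κ Φ t p D (gT 0 (gxA c) κ Φ t p D) (fT 0 fxA κ Φ t p D)).lev du x z)
    (hlev2 : (fcellsA κ Φ t p D (gT 0 (gxA c) κ Φ t p D) (fT 0 fxA κ Φ t p D)).lev du x z ≤ (fcellsA κ Φ t p D (gT 0 (gxA c) κ Φ t p D) (fT 0 fxA κ Φ t p D)).faceL 0 j + (((RlevA κ Φ t p D 0 + reachA t D 0) : ℕ) : ℤ))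
    (hz : |z 1 - (fcellsA κ Φ t p D (gT 0 (gxA c) κ Φ t p D) (fT 0 fxA κ Φ t p D)).cen x 1| ≤ ((prFA κ Φ t p D (gT 0 (gxA c) κ Φ t p D) (fT 0 fxA κ Φ t p D)).kFF₂ (fcellsA κ Φ t p D (gT 0 (gxA c) κ Φ t p D) (fT 0 fxA κ Φ t p D)) ((RlevA κ Φ t p D 0 + reachA t D 0) - 1) 0))
    (r : ℕ) (hr : ∀ X : ℕ, X + 1 ≤ exA κ Φ t p D (gT 0 (gxA c) κ Φ t p D) (fT 0 fxA κ Φ t p D) → X ≤ r) :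
    Skelφ.FloorsX2 (prFA κ Φ t p D (gT 0 (gxA c) κ Φ t p D) (fT 0 fxA κ Φ t p D)) (nL κ Φ t p D (gT 0 (gxA c) κ Φ t p D) (fT 0 fxA κ Φ t p D)) (u₀A κ Φ t p D (gT 0 (gxA c) κ Φ t p D) (fT 0 fxA κ Φ t p D)) (u₁A κ Φ t p D (gT 0 (gxA c) κ Φ t p D) (fT 0 fxA κ Φ t p D))
      (modulus (nL κ Φ t p D (gT 0 (gxA c) κ Φ t p D) (fT 0 fxA κ Φ t p D)) (hL κ Φ t p D (gT 0 (gxA c) κ Φ t p D) (fT 0 fxA κ Φ t p D)) (vL κ Φ t p D (gT 0 (gxA c) κ Φ t p D) (fT 0 fxA κ Φ t p D)) (vβL κ Φ t p D (gT 0 (gxA c) κ Φ t p D) (fT 0 fxA κ Φ t p D))) (nL κ Φ t p D (gT 0 (gxA c) κ Φ t p D) (fT 0 fxA κ Φ t p D) : ℤ) (ℓL κ Φ t p D (gT 0 (gxA c) κ Φ t p D) (fT 0 fxA κ Φ t p D))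
      (fcellsA κ Φ t p D (gT 0 (gxA c) κ Φ t p D) (fT 0 fxA κ Φ t p D)) (b0TA κ Φ t p D (gT 0 (gxA c) κ Φ t p D) (fT 0 fxA κ Φ t p D)) x du j 3 r (Mu D) z
      (fun i => if i = 0 then kF₀A κ Φ t p D c 0 (gT 0 (gxA c) κ Φ t p D) (fT 0 fxA κ Φ t p D) else kF₁A κ Φ t p D c 0 (gT 0 (gxA c) κ Φ t p D) (fT 0 fxA κ Φ t p D))
      (BFs κ Φ t p D c 0 (gT 0 (gxA c) κ Φ t p D) (fT 0 fxA κ Φ t p D) (sgOf du)) (RA' κ Φ t p D 0) (qBXFs κ Φ t p D 0) (RA' κ Φ t p D 0) (qB3XA κ Φ t p D (gT 0 (gxA c) κ Φ t p D) (fT 0 fxA κ Φ t p D) (RA' κ Φ t p D 0))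
      (yLXFs κ Φ t p D c 0 (gT 0 (gxA c) κ Φ t p D) (fT 0 fxA κ Φ t p D) (sgOf du)) (NrX κ Φ t p D (gT 0 (gxA c) κ Φ t p D) (fT 0 fxA κ Φ t p D) (yLXFs κ Φ t p D c 0 (gT 0 (gxA c) κ Φ t p D) (fT 0 fxA κ Φ t p D) (sgOf du)) (σTX κ Φ t p D (gT 0 (gxA c) κ Φ t p D) (fT 0 fxA κ Φ t p D) (yLXFs κ Φ t p D c 0 (gT 0 (gxA c) κ Φ t p D) (fT 0 fxA κ Φ t p D) (sgOf du)) x z) x du z) (N3X κ Φ t p D (gT 0 (gxA c) κ Φ t p D) (fT 0 fxA κ Φ t p D) (yLXFs κ Φ t p D c 0 (gT 0 (gxA c) κ Φ t p D) (fT 0 fxA κ Φ t p D) (sgOf du)) x z) (σTX κ Φ t p D (gT 0 (gxA c) κ Φ t p D) (fT 0 fxA κ Φ t p D) (yLXFs κ Φ t p D c 0 (gT 0 (gxA c) κ Φ t p D) (fT 0 fxA κ Φ t p D) (sgOf du)) x z) := by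
  obtain ⟨hnA, hℓA, hS, hs0, hkF0, hkF1, hEu, hE2, hkE, hkE2⟩ := floorsX2_hyps_A κ Φ t p D c hN hκ
  exact floorsX2_XFs κ Φ t p D c 0 (gxA c) fxA hN hκ hnA hℓA hS hs0 hkF0 hkF1 x du hd j hj z hlev1 hlev2 hz hEu hkE hkE2 hE2 r hr

set_option maxHeartbeats 4000000 in
/-- **M3, x-face, bridge case steep transposed: `Skelφ.FloorsX2` at the (ζ′) slot values, parameter hypotheses discharged** (`KS.floorsX2_XFd` ∘ `KS.floorsX2_hyps_A`). [cite: KozmaNitzan2024, §4 Lemma 11–12 (pp. 21–25)] -/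
theorem floorsX2_XFd_A (c : ℕ)
    (hN : EqNumL κ Φ t p D (gT 0 (gxA c) κ Φ t p D) (fT 0 fxA κ Φ t p D)) (hκ : (hL κ Φ t p D (gT 0 (gxA c) κ Φ t p D) (fT 0 fxA κ Φ t p D)).natAbs ≤ 10 * nL κ Φ t p D (gT 0 (gxA c) κ Φ t p D) (fT 0 fxA κ Φ t p D))
    (x : Site 2) (du : MDir) (hd : du.1 = 0) (j : ℕ) (hj : j < (fcellsA κ Φ t p D (gT 0 (gxA c) κ Φ t p D) (fT 0 fxA κ Φ t p D)).K) (z : Site 2)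
    (hlev1 : (fcellsA κ Φ t p D (gT 0 (gxA c) κ Φ t p D) (fT 0 fxA κ Φ t p D)).faceL 0 j - (((RlevA κ Φ t p D 0 + reachA t D 0) : ℕ) : ℤ) ≤ (fcellsA κ Φ t p D (gT 0 (gxA c) κ Φ t p D) (fT 0 fxA κ Φ t p D)).lev du x z)
    (hlev2 : (fcellsA κ Φ t p D (gT 0 (gxA c) κ Φ t p D) (fT 0 fxA κ Φ t p D)).lev du x z ≤ (fcellsA κ Φ t p D (gT 0 (gxA c) κ Φ t p D) (fT 0 fxA κ Φ t p D)).faceL 0 j + (((RlevA κ Φ t p D 0 + reachA t D 0) : ℕ) : ℤ))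
    (hz : |z 1 - (fcellsA κ Φ t p D (gT 0 (gxA c) κ Φ t p D) (fT 0 fxA κ Φ t p D)).cen x 1| ≤ ((prFA κ Φ t p D (gT 0 (gxA c) κ Φ t p D) (fT 0 fxA κ Φ t p D)).kFF₂ (fcellsA κ Φ t p D (gT 0 (gxA c) κ Φ t p D) (fT 0 fxA κ Φ t p D)) ((RlevA κ Φ t p D 0 + reachA t D 0) - 1) 0))
    (hside : ℓBF κ Φ t p D c 0 < 2 * (hBF κ Φ t p D c 0).natAbs) (hℓb : 2 * bF κ Φ t p D c 0 + 27 ≤ ℓBF κ Φ t p D c 0)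
    (r : ℕ) (hr : ∀ X : ℕ, X + 1 ≤ exA κ Φ t p D (gT 0 (gxA c) κ Φ t p D) (fT 0 fxA κ Φ t p D) → X ≤ r) :
    Skelφ.FloorsX2 (prFA κ Φ t p D (gT 0 (gxA c) κ Φ t p D) (fT 0 fxA κ Φ t p D)) (nL κ Φ t p D (gT 0 (gxA c) κ Φ t p D) (fT 0 fxA κ Φ t p D)) (u₀A κ Φ t p D (gT 0 (gxA c) κ Φ t p D) (fT 0 fxA κ Φ t p D)) (u₁A κ Φ t p D (gT 0 (gxA c) κ Φ t p D) (fT 0 fxA κ Φ t p D))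
      (modulus (nL κ Φ t p D (gT 0 (gxA c) κ Φ t p D) (fT 0 fxA κ Φ t p D)) (hL κ Φ t p D (gT 0 (gxA c) κ Φ t p D) (fT 0 fxA κ Φ t p D)) (vL κ Φ t p D (gT 0 (gxA c) κ Φ t p D) (fT 0 fxA κ Φ t p D)) (vβL κ Φ t p D (gT 0 (gxA c) κ Φ t p D) (fT 0 fxA κ Φ t p D))) (nL κ Φ t p D (gT 0 (gxA c) κ Φ t p D) (fT 0 fxA κ Φ t p D) : ℤ) (ℓL κ Φ t p D (gT 0 (gxA c) κ Φ t p D) (fT 0 fxA κ Φ t p D))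
      (fcellsA κ Φ t p D (gT 0 (gxA c) κ Φ t p D) (fT 0 fxA κ Φ t p D)) (b0TA κ Φ t p D (gT 0 (gxA c) κ Φ t p D) (fT 0 fxA κ Φ t p D)) x du j 3 r (Mu D) z
      (fun i => if i = 0 then kF₀A κ Φ t p D c 0 (gT 0 (gxA c) κ Φ t p D) (fT 0 fxA κ Φ t p D) else kF₁A κ Φ t p D c 0 (gT 0 (gxA c) κ Φ t p D) (fT 0 fxA κ Φ t p D))
      (BFd κ Φ t p D c 0 (gT 0 (gxA c) κ Φ t p D) (fT 0 fxA κ Φ t p D) (sgOf du)) (RA' κ Φ t p D 0) (qBXFd κ Φ t p D c 0) (RA' κ Φ t p D 0) (qB3XA κ Φ t p D (gT 0 (gxA c) κ Φ t p D) (fT 0 fxA κ Φ t p D) (RA' κ Φ t p D 0))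
      (yLXFd κ Φ t p D c 0 (gT 0 (gxA c) κ Φ t p D) (fT 0 fxA κ Φ t p D) (sgOf du)) (NrX κ Φ t p D (gT 0 (gxA c) κ Φ t p D) (fT 0 fxA κ Φ t p D) (yLXFd κ Φ t p D c 0 (gT 0 (gxA c) κ Φ t p D) (fT 0 fxA κ Φ t p D) (sgOf du)) (σTX κ Φ t p D (gT 0 (gxA c) κ Φ t p D) (fT 0 fxA κ Φ t p D) (yLXFd κ Φ t p D c 0 (gT 0 (gxA c) κ Φ t p D) (fT 0 fxA κ Φ t p D) (sgOf du)) x z) x du z) (N3X κ Φ t p D (gT 0 (gxA c) κ Φ t p D) (fT 0 fxA κ Φ t p D) (yLXFd κ Φ t p D c 0 (gT 0 (gxA c) κ Φ t p D) (fT 0 fxA κ Φ t p D) (sgOf du)) x z) (σTX κ Φ t p D (gT 0 (gxA c) κ Φ t p D) (fT 0 fxA κ Φ t p D) (yLXFd κ Φ t p D c 0 (gT 0 (gxA c) κ Φ t p D) (fT 0 fxA κ Φ t p D) (sgOf du)) x z) := by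
  obtain ⟨hnA, hℓA, hS, hs0, hkF0, hkF1, hEu, hE2, hkE, hkE2⟩ := floorsX2_hyps_A κ Φ t p D c hN hκ
  exact floorsX2_XFd κ Φ t p D c 0 (gxA c) fxA hN hκ hnA hℓA hS hs0 hkF0 hkF1 x du hd j hj z hlev1 hlev2 hz hEu hkE hkE2 hE2 hside hℓb r hr

set_option maxHeartbeats 4000000 in
/-- **M3, x-face, bridge case flat transposed: `Skelφ.FloorsX2` at the (ζ′) slot values, parameter hypotheses discharged** (`KS.floorsX2_XFt` ∘ `KS.floorsX2_hyps_A`). [cite: KozmaNitzan2024, §4 Lemma 11–12 (pp. 21–25)] -/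
theorem floorsX2_XFt_A (c : ℕ)
    (hN : EqNumL κ Φ t p D (gT 0 (gxA c) κ Φ t p D) (fT 0 fxA κ Φ t p D)) (hκ : (hL κ Φ t p D (gT 0 (gxA c) κ Φ t p D) (fT 0 fxA κ Φ t p D)).natAbs ≤ 10 * nL κ Φ t p D (gT 0 (gxA c) κ Φ t p D) (fT 0 fxA κ Φ t p D))
    (x : Site 2) (du : MDir) (hd : du.1 = 0) (j : ℕ) (hj : j < (fcellsA κ Φ t p D (gT 0 (gxA c) κ Φ t p D) (fT 0 fxA κ Φ t p D)).K) (z : Site 2)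
    (hlev1 : (fcellsA κ Φ t p D (gT 0 (gxA c) κ Φ t p D) (fT 0 fxA κ Φ t p D)).faceL 0 j - (((RlevA κ Φ t p D 0 + reachA t D 0) : ℕ) : ℤ) ≤ (fcellsA κ Φ t p D (gT 0 (gxA c) κ Φ t p D) (fT 0 fxA κ Φ t p D)).lev du x z)
    (hlev2 : (fcellsA κ Φ t p D (gT 0 (gxA c) κ Φ t p D) (fT 0 fxA κ Φ t p D)).lev du x z ≤ (fcellsA κ Φ t p D (gT 0 (gxA c) κ Φ t p D) (fT 0 fxA κ Φ t p D)).faceL 0 j + (((RlevA κ Φ t p D 0 + reachA t D 0) : ℕ) : ℤ))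
    (hz : |z 1 - (fcellsA κ Φ t p D (gT 0 (gxA c) κ Φ t p D) (fT 0 fxA κ Φ t p D)).cen x 1| ≤ ((prFA κ Φ t p D (gT 0 (gxA c) κ Φ t p D) (fT 0 fxA κ Φ t p D)).kFF₂ (fcellsA κ Φ t p D (gT 0 (gxA c) κ Φ t p D) (fT 0 fxA κ Φ t p D)) ((RlevA κ Φ t p D 0 + reachA t D 0) - 1) 0))
    (htop : 2 * (hBF κ Φ t p D c 0).natAbs ≤ ℓBF κ Φ t p D c 0) (hℓb : 2 * bF κ Φ t p D c 0 + 27 ≤ ℓBF κ Φ t p D c 0)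
    (r : ℕ) (hr : ∀ X : ℕ, X + 1 ≤ exA κ Φ t p D (gT 0 (gxA c) κ Φ t p D) (fT 0 fxA κ Φ t p D) → X ≤ r) :
    Skelφ.FloorsX2 (prFA κ Φ t p D (gT 0 (gxA c) κ Φ t p D) (fT 0 fxA κ Φ t p D)) (nL κ Φ t p D (gT 0 (gxA c) κ Φ t p D) (fT 0 fxA κ Φ t p D)) (u₀A κ Φ t p D (gT 0 (gxA c) κ Φ t p D) (fT 0 fxA κ Φ t p D)) (u₁A κ Φ t p D (gT 0 (gxA c) κ Φ t p D) (fT 0 fxA κ Φ t p D))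
      (modulus (nL κ Φ t p D (gT 0 (gxA c) κ Φ t p D) (fT 0 fxA κ Φ t p D)) (hL κ Φ t p D (gT 0 (gxA c) κ Φ t p D) (fT 0 fxA κ Φ t p D)) (vL κ Φ t p D (gT 0 (gxA c) κ Φ t p D) (fT 0 fxA κ Φ t p D)) (vβL κ Φ t p D (gT 0 (gxA c) κ Φ t p D) (fT 0 fxA κ Φ t p D))) (nL κ Φ t p D (gT 0 (gxA c) κ Φ t p D) (fT 0 fxA κ Φ t p D) : ℤ) (ℓL κ Φ t p D (gT 0 (gxA c) κ Φ t p D) (fT 0 fxA κ Φ t p D))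
      (fcellsA κ Φ t p D (gT 0 (gxA c) κ Φ t p D) (fT 0 fxA κ Φ t p D)) (b0TA κ Φ t p D (gT 0 (gxA c) κ Φ t p D) (fT 0 fxA κ Φ t p D)) x du j 3 r (Mu D) z
      (fun i => if i = 0 then kF₀A κ Φ t p D c 0 (gT 0 (gxA c) κ Φ t p D) (fT 0 fxA κ Φ t p D) else kF₁A κ Φ t p D c 0 (gT 0 (gxA c) κ Φ t p D) (fT 0 fxA κ Φ t p D))
      (BFt κ Φ t p D c 0 (gT 0 (gxA c) κ Φ t p D) (fT 0 fxA κ Φ t p D) (sgOf du)) (RA' κ Φ t p D 0) (qBXFt κ Φ t p D c 0) (RA' κ Φ t p D 0) (qB3XA κ Φ t p D (gT 0 (gxA c) κ Φ t p D) (fT 0 fxA κ Φ t p D) (RA' κ Φ t p D 0))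
      (yLXFt κ Φ t p D c 0 (gT 0 (gxA c) κ Φ t p D) (fT 0 fxA κ Φ t p D) (sgOf du)) (NrX κ Φ t p D (gT 0 (gxA c) κ Φ t p D) (fT 0 fxA κ Φ t p D) (yLXFt κ Φ t p D c 0 (gT 0 (gxA c) κ Φ t p D) (fT 0 fxA κ Φ t p D) (sgOf du)) (σTX κ Φ t p D (gT 0 (gxA c) κ Φ t p D) (fT 0 fxA κ Φ t p D) (yLXFt κ Φ t p D c 0 (gT 0 (gxA c) κ Φ t p D) (fT 0 fxA κ Φ t p D) (sgOf du)) x z) x du z) (N3X κ Φ t p D (gT 0 (gxA c) κ Φ t p D) (fT 0 fxA κ Φ t p D) (yLXFt κ Φ t p D c 0 (gT 0 (gxA c) κ Φ t p D) (fT 0 fxA κ Φ t p D) (sgOf du)) x z) (σTX κ Φ t p D (gT 0 (gxA c) κ Φ t p D) (fT 0 fxA κ Φ t p D) (yLXFt κ Φ t p D c 0 (gT 0 (gxA c) κ Φ t p D) (fT 0 fxA κ Φ t p D) (sgOf du)) x z) := by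
  obtain ⟨hnA, hℓA, hS, hs0, hkF0, hkF1, hEu, hE2, hkE, hkE2⟩ := floorsX2_hyps_A κ Φ t p D c hN hκ
  exact floorsX2_XFt κ Φ t p D c 0 (gxA c) fxA hN hκ hnA hℓA hS hs0 hkF0 hkF1 x du hd j hj z hlev1 hlev2 hz hEu hkE hkE2 hE2 htop hℓb r hr

set_option maxHeartbeats 4000000 in
/-- **The x-face floors in the (F) glue's binder shape, bridge case `same (`KS.BFs`)`** (`du.1`, `oth du.1`, `kFF₂ … du.1` as the provider layer
`NegB.faceOblRM_negBTB₄?` binds them; hp-8 F-GLUE-CONSUMER-SHAPE.md §3). [cite: KozmaNitzan2024, §4 Lemma 11–12 (pp. 21–25)] -/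
theorem floorsX_XFs_A (c : ℕ) (hN : EqNumL κ Φ t p D (gT 0 (gxA c) κ Φ t p D) (fT 0 fxA κ Φ t p D)) (hκ : (hL κ Φ t p D (gT 0 (gxA c) κ Φ t p D) (fT 0 fxA κ Φ t p D)).natAbs ≤ 10 * nL κ Φ t p D (gT 0 (gxA c) κ Φ t p D) (fT 0 fxA κ Φ t p D))
    (r : ℕ) (hr : ∀ X : ℕ, X + 1 ≤ exA κ Φ t p D (gT 0 (gxA c) κ Φ t p D) (fT 0 fxA κ Φ t p D) → X ≤ r) :
    ∀ (x : Site 2) (du : MDir) (j : ℕ) (z : Site 2), du.1 = 0 → j < (fcellsA κ Φ t p D (gT 0 (gxA c) κ Φ t p D) (fT 0 fxA κ Φ t p D)).K →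
      ((fcellsA κ Φ t p D (gT 0 (gxA c) κ Φ t p D) (fT 0 fxA κ Φ t p D)).faceL du.1 j : ℤ) - (((RlevA κ Φ t p D 0 + reachA t D 0) : ℕ) : ℤ) ≤ (fcellsA κ Φ t p D (gT 0 (gxA c) κ Φ t p D) (fT 0 fxA κ Φ t p D)).lev du x z →
      (fcellsA κ Φ t p D (gT 0 (gxA c) κ Φ t p D) (fT 0 fxA κ Φ t p D)).lev du x z ≤ (fcellsA κ Φ t p D (gT 0 (gxA c) κ Φ t p D) (fT 0 fxA κ Φ t p D)).faceL du.1 j + (((RlevA κ Φ t p D 0 + reachA t D 0) : ℕ) : ℤ) →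
      |z (oth du.1) - (fcellsA κ Φ t p D (gT 0 (gxA c) κ Φ t p D) (fT 0 fxA κ Φ t p D)).cen x (oth du.1)| ≤ (prFA κ Φ t p D (gT 0 (gxA c) κ Φ t p D) (fT 0 fxA κ Φ t p D)).kFF₂ (fcellsA κ Φ t p D (gT 0 (gxA c) κ Φ t p D) (fT 0 fxA κ Φ t p D)) ((RlevA κ Φ t p D 0 + reachA t D 0) - 1) du.1 →
    Skelφ.FloorsX2 (prFA κ Φ t p D (gT 0 (gxA c) κ Φ t p D) (fT 0 fxA κ Φ t p D)) (nL κ Φ t p D (gT 0 (gxA c) κ Φ t p D) (fT 0 fxA κ Φ t p D)) (u₀A κ Φ t p D (gT 0 (gxA c) κ Φ t p D) (fT 0 fxA κ Φ t p D)) (u₁A κ Φ t p D (gT 0 (gxA c) κ Φ t p D) (fT 0 fxA κ Φ t p D))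
      (modulus (nL κ Φ t p D (gT 0 (gxA c) κ Φ t p D) (fT 0 fxA κ Φ t p D)) (hL κ Φ t p D (gT 0 (gxA c) κ Φ t p D) (fT 0 fxA κ Φ t p D)) (vL κ Φ t p D (gT 0 (gxA c) κ Φ t p D) (fT 0 fxA κ Φ t p D)) (vβL κ Φ t p D (gT 0 (gxA c) κ Φ t p D) (fT 0 fxA κ Φ t p D))) (nL κ Φ t p D (gT 0 (gxA c) κ Φ t p D) (fT 0 fxA κ Φ t p D) : ℤ) (ℓL κ Φ t p D (gT 0 (gxA c) κ Φ t p D) (fT 0 fxA κ Φ t p D))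
      (fcellsA κ Φ t p D (gT 0 (gxA c) κ Φ t p D) (fT 0 fxA κ Φ t p D)) (b0TA κ Φ t p D (gT 0 (gxA c) κ Φ t p D) (fT 0 fxA κ Φ t p D)) x du j 3 r (Mu D) z
      (fun i => if i = 0 then kF₀A κ Φ t p D c 0 (gT 0 (gxA c) κ Φ t p D) (fT 0 fxA κ Φ t p D) else kF₁A κ Φ t p D c 0 (gT 0 (gxA c) κ Φ t p D) (fT 0 fxA κ Φ t p D))
      (BFs κ Φ t p D c 0 (gT 0 (gxA c) κ Φ t p D) (fT 0 fxA κ Φ t p D) (sgOf du)) (RA' κ Φ t p D 0) (qBXFs κ Φ t p D 0) (RA' κ Φ t p D 0) (qB3XA κ Φ t p D (gT 0 (gxA c) κ Φ t p D) (fT 0 fxA κ Φ t p D) (RA' κ Φ t p D 0))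
      (yLXFs κ Φ t p D c 0 (gT 0 (gxA c) κ Φ t p D) (fT 0 fxA κ Φ t p D) (sgOf du)) (NrX κ Φ t p D (gT 0 (gxA c) κ Φ t p D) (fT 0 fxA κ Φ t p D) (yLXFs κ Φ t p D c 0 (gT 0 (gxA c) κ Φ t p D) (fT 0 fxA κ Φ t p D) (sgOf du)) (σTX κ Φ t p D (gT 0 (gxA c) κ Φ t p D) (fT 0 fxA κ Φ t p D) (yLXFs κ Φ t p D c 0 (gT 0 (gxA c) κ Φ t p D) (fT 0 fxA κ Φ t p D) (sgOf du)) x z) x du z) (N3X κ Φ t p D (gT 0 (gxA c) κ Φ t p D) (fT 0 fxA κ Φ t p D) (yLXFs κ Φ t p D c 0 (gT 0 (gxA c) κ Φ t p D) (fT 0 fxA κ Φ t p D) (sgOf du)) x z) (σTX κ Φ t p D (gT 0 (gxA c) κ Φ t p D) (fT 0 fxA κ Φ t p D) (yLXFs κ Φ t p D c 0 (gT 0 (gxA c) κ Φ t p D) (fT 0 fxA κ Φ t p D) (sgOf du)) x z) := by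
  intro x du j z hd hj hlev1 hlev2 hz
  obtain ⟨i, sδ⟩ := du
  change i = 0 at hd
  subst hd
  exact floorsX2_XFs_A κ Φ t p D c hN hκ x ((0 : Fin 2), sδ) rfl j hj z hlev1 hlev2 hz r hr

set_option maxHeartbeats 4000000 in
/-- **The x-face floors in the (F) glue's binder shape, bridge case `steep transposed (`KS.BFd`)`** (`du.1`, `oth du.1`, `kFF₂ … du.1` as the provider layer
`NegB.faceOblRM_negBTB₄?` binds them; hp-8 F-GLUE-CONSUMER-SHAPE.md §3). [cite: KozmaNitzan2024, §4 Lemma 11–12 (pp. 21–25)] -/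
theorem floorsX_XFd_A (c : ℕ) (hN : EqNumL κ Φ t p D (gT 0 (gxA c) κ Φ t p D) (fT 0 fxA κ Φ t p D)) (hκ : (hL κ Φ t p D (gT 0 (gxA c) κ Φ t p D) (fT 0 fxA κ Φ t p D)).natAbs ≤ 10 * nL κ Φ t p D (gT 0 (gxA c) κ Φ t p D) (fT 0 fxA κ Φ t p D))
    (hside : ℓBF κ Φ t p D c 0 < 2 * (hBF κ Φ t p D c 0).natAbs) (hℓb : 2 * bF κ Φ t p D c 0 + 27 ≤ ℓBF κ Φ t p D c 0)
    (r : ℕ) (hr : ∀ X : ℕ, X + 1 ≤ exA κ Φ t p D (gT 0 (gxA c) κ Φ t p D) (fT 0 fxA κ Φ t p D) → X ≤ r) :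
    ∀ (x : Site 2) (du : MDir) (j : ℕ) (z : Site 2), du.1 = 0 → j < (fcellsA κ Φ t p D (gT 0 (gxA c) κ Φ t p D) (fT 0 fxA κ Φ t p D)).K →
      ((fcellsA κ Φ t p D (gT 0 (gxA c) κ Φ t p D) (fT 0 fxA κ Φ t p D)).faceL du.1 j : ℤ) - (((RlevA κ Φ t p D 0 + reachA t D 0) : ℕ) : ℤ) ≤ (fcellsA κ Φ t p D (gT 0 (gxA c) κ Φ t p D) (fT 0 fxA κ Φ t p D)).lev du x z →
      (fcellsA κ Φ t p D (gT 0 (gxA c) κ Φ t p D) (fT 0 fxA κ Φ t p D)).lev du x z ≤ (fcellsA κ Φ t p D (gT 0 (gxA c) κ Φ t p D) (fT 0 fxA κ Φ t p D)).faceL du.1 j + (((RlevA κ Φ t p D 0 + reachA t D 0) : ℕ) : ℤ) →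
      |z (oth du.1) - (fcellsA κ Φ t p D (gT 0 (gxA c) κ Φ t p D) (fT 0 fxA κ Φ t p D)).cen x (oth du.1)| ≤ (prFA κ Φ t p D (gT 0 (gxA c) κ Φ t p D) (fT 0 fxA κ Φ t p D)).kFF₂ (fcellsA κ Φ t p D (gT 0 (gxA c) κ Φ t p D) (fT 0 fxA κ Φ t p D)) ((RlevA κ Φ t p D 0 + reachA t D 0) - 1) du.1 →
    Skelφ.FloorsX2 (prFA κ Φ t p D (gT 0 (gxA c) κ Φ t p D) (fT 0 fxA κ Φ t p D)) (nL κ Φ t p D (gT 0 (gxA c) κ Φ t p D) (fT 0 fxA κ Φ t p D)) (u₀A κ Φ t p D (gT 0 (gxA c) κ Φ t p D) (fT 0 fxA κ Φ t p D)) (u₁A κ Φ t p D (gT 0 (gxA c) κ Φ t p D) (fT 0 fxA κ Φ t p D))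
      (modulus (nL κ Φ t p D (gT 0 (gxA c) κ Φ t p D) (fT 0 fxA κ Φ t p D)) (hL κ Φ t p D (gT 0 (gxA c) κ Φ t p D) (fT 0 fxA κ Φ t p D)) (vL κ Φ t p D (gT 0 (gxA c) κ Φ t p D) (fT 0 fxA κ Φ t p D)) (vβL κ Φ t p D (gT 0 (gxA c) κ Φ t p D) (fT 0 fxA κ Φ t p D))) (nL κ Φ t p D (gT 0 (gxA c) κ Φ t p D) (fT 0 fxA κ Φ t p D) : ℤ) (ℓL κ Φ t p D (gT 0 (gxA c) κ Φ t p D) (fT 0 fxA κ Φ t p D))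
      (fcellsA κ Φ t p D (gT 0 (gxA c) κ Φ t p D) (fT 0 fxA κ Φ t p D)) (b0TA κ Φ t p D (gT 0 (gxA c) κ Φ t p D) (fT 0 fxA κ Φ t p D)) x du j 3 r (Mu D) z
      (fun i => if i = 0 then kF₀A κ Φ t p D c 0 (gT 0 (gxA c) κ Φ t p D) (fT 0 fxA κ Φ t p D) else kF₁A κ Φ t p D c 0 (gT 0 (gxA c) κ Φ t p D) (fT 0 fxA κ Φ t p D))
      (BFd κ Φ t p D c 0 (gT 0 (gxA c) κ Φ t p D) (fT 0 fxA κ Φ t p D) (sgOf du)) (RA' κ Φ t p D 0) (qBXFd κ Φ t p D c 0) (RA' κ Φ t p D 0) (qB3XA κ Φ t p D (gT 0 (gxA c) κ Φ t p D) (fT 0 fxA κ Φ t p D) (RA' κ Φ t p D 0))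
      (yLXFd κ Φ t p D c 0 (gT 0 (gxA c) κ Φ t p D) (fT 0 fxA κ Φ t p D) (sgOf du)) (NrX κ Φ t p D (gT 0 (gxA c) κ Φ t p D) (fT 0 fxA κ Φ t p D) (yLXFd κ Φ t p D c 0 (gT 0 (gxA c) κ Φ t p D) (fT 0 fxA κ Φ t p D) (sgOf du)) (σTX κ Φ t p D (gT 0 (gxA c) κ Φ t p D) (fT 0 fxA κ Φ t p D) (yLXFd κ Φ t p D c 0 (gT 0 (gxA c) κ Φ t p D) (fT 0 fxA κ Φ t p D) (sgOf du)) x z) x du z) (N3X κ Φ t p D (gT 0 (gxA c) κ Φ t p D) (fT 0 fxA κ Φ t p D) (yLXFd κ Φ t p D c 0 (gT 0 (gxA c) κ Φ t p D) (fT 0 fxA κ Φ t p D) (sgOf du)) x z) (σTX κ Φ t p D (gT 0 (gxA c) κ Φ t p D) (fT 0 fxA κ Φ t p D) (yLXFd κ Φ t p D c 0 (gT 0 (gxA c) κ Φ t p D) (fT 0 fxA κ Φ t p D) (sgOf du)) x z) := by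
  intro x du j z hd hj hlev1 hlev2 hz
  obtain ⟨i, sδ⟩ := du
  change i = 0 at hd
  subst hd
  exact floorsX2_XFd_A κ Φ t p D c hN hκ x ((0 : Fin 2), sδ) rfl j hj z hlev1 hlev2 hz hside hℓb r hr

set_option maxHeartbeats 4000000 in
/-- **The x-face floors in the (F) glue's binder shape, bridge case `flat transposed (`KS.BFt`)`** (`du.1`, `oth du.1`, `kFF₂ … du.1` as the provider layer
`NegB.faceOblRM_negBTB₄?` binds them; hp-8 F-GLUE-CONSUMER-SHAPE.md §3). [cite: KozmaNitzan2024, §4 Lemma 11–12 (pp. 21–25)] -/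
theorem floorsX_XFt_A (c : ℕ) (hN : EqNumL κ Φ t p D (gT 0 (gxA c) κ Φ t p D) (fT 0 fxA κ Φ t p D)) (hκ : (hL κ Φ t p D (gT 0 (gxA c) κ Φ t p D) (fT 0 fxA κ Φ t p D)).natAbs ≤ 10 * nL κ Φ t p D (gT 0 (gxA c) κ Φ t p D) (fT 0 fxA κ Φ t p D))
    (htop : 2 * (hBF κ Φ t p D c 0).natAbs ≤ ℓBF κ Φ t p D c 0) (hℓb : 2 * bF κ Φ t p D c 0 + 27 ≤ ℓBF κ Φ t p D c 0)
    (r : ℕ) (hr : ∀ X : ℕ, X + 1 ≤ exA κ Φ t p D (gT 0 (gxA c) κ Φ t p D) (fT 0 fxA κ Φ t p D) → X ≤ r) :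
    ∀ (x : Site 2) (du : MDir) (j : ℕ) (z : Site 2), du.1 = 0 → j < (fcellsA κ Φ t p D (gT 0 (gxA c) κ Φ t p D) (fT 0 fxA κ Φ t p D)).K →
      ((fcellsA κ Φ t p D (gT 0 (gxA c) κ Φ t p D) (fT 0 fxA κ Φ t p D)).faceL du.1 j : ℤ) - (((RlevA κ Φ t p D 0 + reachA t D 0) : ℕ) : ℤ) ≤ (fcellsA κ Φ t p D (gT 0 (gxA c) κ Φ t p D) (fT 0 fxA κ Φ t p D)).lev du x z →
      (fcellsA κ Φ t p D (gT 0 (gxA c) κ Φ t p D) (fT 0 fxA κ Φ t p D)).lev du x z ≤ (fcellsA κ Φ t p D (gT 0 (gxA c) κ Φ t p D) (fT 0 fxA κ Φ t p D)).faceL du.1 j + (((RlevA κ Φ t p D 0 + reachA t D 0) : ℕ) : ℤ) →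
      |z (oth du.1) - (fcellsA κ Φ t p D (gT 0 (gxA c) κ Φ t p D) (fT 0 fxA κ Φ t p D)).cen x (oth du.1)| ≤ (prFA κ Φ t p D (gT 0 (gxA c) κ Φ t p D) (fT 0 fxA κ Φ t p D)).kFF₂ (fcellsA κ Φ t p D (gT 0 (gxA c) κ Φ t p D) (fT 0 fxA κ Φ t p D)) ((RlevA κ Φ t p D 0 + reachA t D 0) - 1) du.1 →
    Skelφ.FloorsX2 (prFA κ Φ t p D (gT 0 (gxA c) κ Φ t p D) (fT 0 fxA κ Φ t p D)) (nL κ Φ t p D (gT 0 (gxA c) κ Φ t p D) (fT 0 fxA κ Φ t p D)) (u₀A κ Φ t p D (gT 0 (gxA c) κ Φ t p D) (fT 0 fxA κ Φ t p D)) (u₁A κ Φ t p D (gT 0 (gxA c) κ Φ t p D) (fT 0 fxA κ Φ t p D))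
      (modulus (nL κ Φ t p D (gT 0 (gxA c) κ Φ t p D) (fT 0 fxA κ Φ t p D)) (hL κ Φ t p D (gT 0 (gxA c) κ Φ t p D) (fT 0 fxA κ Φ t p D)) (vL κ Φ t p D (gT 0 (gxA c) κ Φ t p D) (fT 0 fxA κ Φ t p D)) (vβL κ Φ t p D (gT 0 (gxA c) κ Φ t p D) (fT 0 fxA κ Φ t p D))) (nL κ Φ t p D (gT 0 (gxA c) κ Φ t p D) (fT 0 fxA κ Φ t p D) : ℤ) (ℓL κ Φ t p D (gT 0 (gxA c) κ Φ t p D) (fT 0 fxA κ Φ t p D))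
      (fcellsA κ Φ t p D (gT 0 (gxA c) κ Φ t p D) (fT 0 fxA κ Φ t p D)) (b0TA κ Φ t p D (gT 0 (gxA c) κ Φ t p D) (fT 0 fxA κ Φ t p D)) x du j 3 r (Mu D) z
      (fun i => if i = 0 then kF₀A κ Φ t p D c 0 (gT 0 (gxA c) κ Φ t p D) (fT 0 fxA κ Φ t p D) else kF₁A κ Φ t p D c 0 (gT 0 (gxA c) κ Φ t p D) (fT 0 fxA κ Φ t p D))
      (BFt κ Φ t p D c 0 (gT 0 (gxA c) κ Φ t p D) (fT 0 fxA κ Φ t p D) (sgOf du)) (RA' κ Φ t p D 0) (qBXFt κ Φ t p D c 0) (RA' κ Φ t p D 0) (qB3XA κ Φ t p D (gT 0 (gxA c) κ Φ t p D) (fT 0 fxA κ Φ t p D) (RA' κ Φ t p D 0))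
      (yLXFt κ Φ t p D c 0 (gT 0 (gxA c) κ Φ t p D) (fT 0 fxA κ Φ t p D) (sgOf du)) (NrX κ Φ t p D (gT 0 (gxA c) κ Φ t p D) (fT 0 fxA κ Φ t p D) (yLXFt κ Φ t p D c 0 (gT 0 (gxA c) κ Φ t p D) (fT 0 fxA κ Φ t p D) (sgOf du)) (σTX κ Φ t p D (gT 0 (gxA c) κ Φ t p D) (fT 0 fxA κ Φ t p D) (yLXFt κ Φ t p D c 0 (gT 0 (gxA c) κ Φ t p D) (fT 0 fxA κ Φ t p D) (sgOf du)) x z) x du z) (N3X κ Φ t p D (gT 0 (gxA c) κ Φ t p D) (fT 0 fxA κ Φ t p D) (yLXFt κ Φ t p D c 0 (gT 0 (gxA c) κ Φ t p D) (fT 0 fxA κ Φ t p D) (sgOf du)) x z) (σTX κ Φ t p D (gT 0 (gxA c) κ Φ t p D) (fT 0 fxA κ Φ t p D) (yLXFt κ Φ t p D c 0 (gT 0 (gxA c) κ Φ t p D) (fT 0 fxA κ Φ t p D) (sgOf du)) x z) := by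
  intro x du j z hd hj hlev1 hlev2 hz
  obtain ⟨i, sδ⟩ := du
  change i = 0 at hd
  subst hd
  exact floorsX2_XFt_A κ Φ t p D c hN hκ x ((0 : Fin 2), sδ) rfl j hj z hlev1 hlev2 hz htop hℓb r hr

end KS

end NegB

end PlanarSkeletonNeg

end Summit.CriticalPhenomena.PercolationContinuityZ3.Theorems.Transplant

end
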